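import Summits.CriticalPhenomena.CardyFormulaZ2.Theorems.CardyBoundaryCoulombGasHalfPlaneMarkDensityLawNecessity

/-!
# Line `Sketch` — the one open stub `stub_collinearCardy` (C⁺) written as a self-contained ITEM
# SIGNATURE in the route's own vocabulary (crux stmt-CriticalPhenomena-5661, lead c1-0, promote-stub)

The registered stub `stub_collinearCardy` of line `Sketch` is phrased through the support-file vocabulary
`μ`, `halfPlane`, `arcA`, `rowIcc` of `Negative.MarkEvents`.  For the planner who promotes it to a typed
item (it is crux-sized: EQUIVALENT to the crux, `stub_equivalence`, and implied by the conjunct,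
`collinearCardy_of_cardyFormulaZ2`), this file gives the same statement with every piece inlined in the
exact style of the route file (`bondPercolation (zdGraph 2) half`, set-builder arcs, `Filter.atTop`, `nhds`),
proves by `Iff.rfl` that it IS the stub's statement, and records its position: `↔` crux 5,
`⟸` crux 4 (`RectilinearCardy`), `⟸` the conjunct.  Nothing is defined; no statement of the tree is
restated under a new name (the inlined Prop appears only inside theorem types).
-/

noncomputable section

namespace Summit.CriticalPhenomena.CardyFormulaZ2.Cruxes.HalfPlaneMarkDensityLaw.SketchLine

open Literature.Probability.Percolation Literature.Probability.LatticeModels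
open MeasureTheory Filter Set
open scoped Topology
open Summit.CriticalPhenomena.CardyFormulaZ2.Theses.CardyBoundaryCoulombGas
  (HalfPlaneMarkDensityLaw RectilinearCardy)
open Summit.CriticalPhenomena.CardyFormulaZ2.Theorems.HalfPlaneMarkDensityLaw.Negative

/-- **C⁺ in route vocabulary is literally the registered stub.**  The collinear half-plane Cardy law for
bond-`ℤ²` at `p = 1/2` — for reals `a < b < c < y`, the `P_{1/2}`-probability that the boundary arcs
`[⌊an⌋,⌊bn⌋]×{0}` and `[⌊cn⌋,⌊yn⌋]×{0}` are joined by an open path of the lattice half-plane `ℤ×ℕ` tends to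
`F(η(a,b,c,y))` — written with every piece inlined (left) is definitionally the statement of
`stub_collinearCardy` (right). [folklore] -/
theorem collinearCardy_routeForm_iff :
    (∀ a b c y : ℝ, a < b → b < c → c < y →
      Filter.Tendsto (fun n : ℕ ↦
        (Literature.Probability.Percolation.bondPercolation (Literature.Probability.LatticeModels.zdGraph 2)
            Literature.Probability.Percolation.half).real
          (Literature.Probability.Percolation.openCrossing
            {v : Literature.Probability.LatticeModels.Site 2 | 0 ≤ v 1}
            {v | v 1 = 0 ∧ ⌊a * n⌋ ≤ v 0 ∧ v 0 ≤ ⌊b * n⌋}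
            {v | v 1 = 0 ∧ ⌊c * n⌋ ≤ v 0 ∧ v 0 ≤ ⌊y * n⌋}))
        Filter.atTop
        (nhds (Literature.Probability.RandomPlanarGeometry.cardyFunction
          (Literature.Probability.RandomPlanarGeometry.crossRatio ![a, b, c, y])))) ↔
    (∀ a b c y : ℝ, a < b → b < c → c < y →
      Tendsto (fun n : ℕ ↦ μ.real (openCrossing halfPlane (arcA a b n) (rowIcc ⌊c * n⌋ ⌊y * n⌋))) atTop
        (𝓝 (Literature.Probability.RandomPlanarGeometry.cardyFunction
          (Literature.Probability.RandomPlanarGeometry.crossRatio ![a, b, c, y])))) :=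
  Iff.rfl

/-- **Crux 5 ⟺ C⁺ (route vocabulary).**  `HalfPlaneMarkDensityLaw` is equivalent to the inlined collinear
half-plane Cardy law (`stub_converse`/`stub_reduction` transported along `collinearCardy_routeForm_iff`). [folklore] -/
theorem halfPlaneMarkDensityLaw_iff_collinearCardy_routeForm :
    HalfPlaneMarkDensityLaw ↔
    (∀ a b c y : ℝ, a < b → b < c → c < y →
      Filter.Tendsto (fun n : ℕ ↦
        (Literature.Probability.Percolation.bondPercolation (Literature.Probability.LatticeModels.zdGraph 2)
            Literature.Probability.Percolation.half).real
          (Literature.Probability.Percolation.openCrossing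
            {v : Literature.Probability.LatticeModels.Site 2 | 0 ≤ v 1}
            {v | v 1 = 0 ∧ ⌊a * n⌋ ≤ v 0 ∧ v 0 ≤ ⌊b * n⌋}
            {v | v 1 = 0 ∧ ⌊c * n⌋ ≤ v 0 ∧ v 0 ≤ ⌊y * n⌋}))
        Filter.atTop
        (nhds (Literature.Probability.RandomPlanarGeometry.cardyFunction
          (Literature.Probability.RandomPlanarGeometry.crossRatio ![a, b, c, y])))) :=
  (Iff.intro stub_converse stub_reduction).trans collinearCardy_routeForm_iff.symm

/-- **Crux 4 ⟹ C⁺ (route vocabulary)**: `RectilinearCardy` implies the inlined collinear half-plane Cardy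
law (box exhaustion, `collinearCardy_of_rectilinearCardy`). [folklore] -/
theorem collinearCardy_routeForm_of_rectilinearCardy (h : RectilinearCardy) :
    ∀ a b c y : ℝ, a < b → b < c → c < y →
      Filter.Tendsto (fun n : ℕ ↦
        (Literature.Probability.Percolation.bondPercolation (Literature.Probability.LatticeModels.zdGraph 2)
            Literature.Probability.Percolation.half).real
          (Literature.Probability.Percolation.openCrossing
            {v : Literature.Probability.LatticeModels.Site 2 | 0 ≤ v 1}
            {v | v 1 = 0 ∧ ⌊a * n⌋ ≤ v 0 ∧ v 0 ≤ ⌊b * n⌋}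
            {v | v 1 = 0 ∧ ⌊c * n⌋ ≤ v 0 ∧ v 0 ≤ ⌊y * n⌋}))
        Filter.atTop
        (nhds (Literature.Probability.RandomPlanarGeometry.cardyFunction
          (Literature.Probability.RandomPlanarGeometry.crossRatio ![a, b, c, y]))) :=
  collinearCardy_routeForm_iff.mpr (collinearCardy_of_rectilinearCardy h)

/-- **Conjunct ⟹ C⁺ (route vocabulary)**: `CardyFormulaZ2` implies the inlined collinear half-plane Cardy
law (`collinearCardy_of_cardyFormulaZ2`). [folklore] -/
theorem collinearCardy_routeForm_of_cardyFormulaZ2 (h : _root_.CardyFormulaZ2) :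
    ∀ a b c y : ℝ, a < b → b < c → c < y →
      Filter.Tendsto (fun n : ℕ ↦
        (Literature.Probability.Percolation.bondPercolation (Literature.Probability.LatticeModels.zdGraph 2)
            Literature.Probability.Percolation.half).real
          (Literature.Probability.Percolation.openCrossing
            {v : Literature.Probability.LatticeModels.Site 2 | 0 ≤ v 1}
            {v | v 1 = 0 ∧ ⌊a * n⌋ ≤ v 0 ∧ v 0 ≤ ⌊b * n⌋}
            {v | v 1 = 0 ∧ ⌊c * n⌋ ≤ v 0 ∧ v 0 ≤ ⌊y * n⌋}))
        Filter.atTop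
        (nhds (Literature.Probability.RandomPlanarGeometry.cardyFunction
          (Literature.Probability.RandomPlanarGeometry.crossRatio ![a, b, c, y]))) :=
  collinearCardy_routeForm_iff.mpr (collinearCardy_of_cardyFormulaZ2 h)

end Summit.CriticalPhenomena.CardyFormulaZ2.Cruxes.HalfPlaneMarkDensityLaw.SketchLine
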